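import Summits.BirchSwinnertonDyer.BirchSwinnertonDyer.Theorems.SignedLowerHalvesSmallImageLowerHalfBothSignsRttCharRoadE2QuasiIso
import Summits.BirchSwinnertonDyer.BirchSwinnertonDyer.Theorems.SignedLowerHalvesSmallImageLowerHalfBothSignsRttCharRoadE2QuasiIsoQuotient
import Literature.NumberTheory.EllipticCurves.SharpFlatPAdicLFunctionCoeffField
import HarnessLib

/-!
# Route `SignedLowerHalves`, crux L `SmallImageLowerHalfBothSigns` (stmt-BirchSwinnertonDyer-23599), line `rtt_w3` v13 — E2, row (6′) E2-K JUNCTION SOCKET, LEAD: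
# `hK` TRANSPORTS ALONG TWO `Λ_𝒪`-LINEAR QUASI-ISOMORPHISMS (`Hsp → ker gX` with `zetaSp ↦ z`, `Ysp → coker gX`)

WHY (BRIEF-E2 rev 3.1 §2 row `hK`, §3 row (6′), `Lines/rtt_w3-BRIEF-E2-g9b.md`). The glue `charRoad_E2_of_localisation` (p776213) consumes
`hK : λ(ker gX ⧸ Λ_𝒪∙z) ≤ λ(coker gX)`; road D delivers (-w3 g19, `SmallImageRttD2LamSpec.lambdaInvariant_quotient_span_zetaSp_le_of_thm52Shape_of_linearEquiv`, from
honda's fact `cor53_thm52ShapeO`) the inequality `λ(Hsp ⧸ Λ_𝒪∙zetaSp) ≤ λ(Ysp)` on the θ-SPECIALISED JLK carriers. Row (6′) — the E2-K junction — must identify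
the two sides; this file fixes its DELIVERABLE SHAPE and proves that it suffices (`lambdaInvariant_quotient_span_le_of_quasiIso`): two `Λ_𝒪`-linear maps
`eH : H' → H` with `eH z' = z` and `eY : Y' → Y`, each with FINITE kernel and cokernel, transport `λ(H' ⧸ Λ_𝒪∙z') ≤ λ(Y')` to `λ(H ⧸ Λ_𝒪∙z) ≤ λ(Y)`
(quasi-isomorphisms descend to quotients by a cyclic submodule, p776462; `λ` is invariant under quasi-isomorphisms, p776013). THEOREMS ONLY; nothing about E2 itself
is proved. [cite: Washington1997, §13.2] [folklore]
-/

set_option linter.dupNamespace false -- D-0017: single-problem summit, the namespace repeats the problem name by design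
set_option autoImplicit false

noncomputable section

namespace Summit.BirchSwinnertonDyer.BirchSwinnertonDyer.Theorems.SmallImageRttCharRoad

open Literature.NumberTheory.EllipticCurves

variable {p : ℕ} [Fact p.Prime] {S : Set (PadicAlgCl p)} [Algebra (IwasawaAlgebra p) (IwasawaAlgebraO S)]

/-- **`λ` of a `Λ`-restricted quasi-isomorphism of `Λ_𝒪`-modules.** A `Λ_𝒪`-linear map with finite kernel and cokernel between `Λ_𝒪`-modules carrying scalar-tower
`Λ`-structures preserves `lambdaInvariant p`. [cite: Washington1997, §13.2] [folklore] -/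
theorem lambdaInvariant_eq_of_finite_ker_coker_iwasawaAlgebraO {M N : Type} [AddCommGroup M] [AddCommGroup N]
    [Module (IwasawaAlgebraO S) M] [Module (IwasawaAlgebra p) M] [IsScalarTower (IwasawaAlgebra p) (IwasawaAlgebraO S) M]
    [Module (IwasawaAlgebraO S) N] [Module (IwasawaAlgebra p) N] [IsScalarTower (IwasawaAlgebra p) (IwasawaAlgebraO S) N]
    (e : M →ₗ[IwasawaAlgebraO S] N) (hker : Finite (LinearMap.ker e)) (hcoker : Finite (N ⧸ LinearMap.range e)) :
    lambdaInvariant p M = lambdaInvariant p N := by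
  refine lambdaInvariant_eq_of_finite_ker_coker (e.restrictScalars (IwasawaAlgebra p)) ?_ ?_
  · rw [LinearMap.ker_restrictScalars]
    exact hker
  · exact Finite.of_equiv _ (Submodule.Quotient.restrictScalarsEquiv (IwasawaAlgebra p) (LinearMap.range e)).toEquiv.symm

/-- **The E2-K junction socket.** `Λ_𝒪`-modules `H, Y, H', Y'` with scalar-tower `Λ`-structures; `Λ_𝒪`-linear `eH : H' → H`, `eY : Y' → Y` with FINITE kernels and
cokernels, `eH z' = z`. Then `λ(H' ⧸ Λ_𝒪∙z') ≤ λ(Y')` implies `λ(H ⧸ Λ_𝒪∙z) ≤ λ(Y)` — the `hK` of `charRoad_E2_of_localisation` (`H := ker gX`, `Y := coker gX`) from road D's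
inequality on the θ-specialised carriers (`H' := Hsp`, `z' := zetaSp`, `Y' := Ysp`). [cite: Washington1997, §13.2] [folklore] -/
theorem lambdaInvariant_quotient_span_le_of_quasiIso {H Y H' Y' : Type} [AddCommGroup H] [AddCommGroup Y] [AddCommGroup H'] [AddCommGroup Y']
    [Module (IwasawaAlgebraO S) H] [Module (IwasawaAlgebra p) H] [IsScalarTower (IwasawaAlgebra p) (IwasawaAlgebraO S) H]
    [Module (IwasawaAlgebraO S) Y] [Module (IwasawaAlgebra p) Y] [IsScalarTower (IwasawaAlgebra p) (IwasawaAlgebraO S) Y]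
    [Module (IwasawaAlgebraO S) H'] [Module (IwasawaAlgebra p) H'] [IsScalarTower (IwasawaAlgebra p) (IwasawaAlgebraO S) H']
    [Module (IwasawaAlgebraO S) Y'] [Module (IwasawaAlgebra p) Y'] [IsScalarTower (IwasawaAlgebra p) (IwasawaAlgebraO S) Y']
    (z : H) (z' : H') (eH : H' →ₗ[IwasawaAlgebraO S] H) (heH : eH z' = z)
    (hkerH : Finite (LinearMap.ker eH)) (hcokerH : Finite (H ⧸ LinearMap.range eH))
    (eY : Y' →ₗ[IwasawaAlgebraO S] Y) (hkerY : Finite (LinearMap.ker eY)) (hcokerY : Finite (Y ⧸ LinearMap.range eY))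
    (hK' : lambdaInvariant p (H' ⧸ Submodule.span (IwasawaAlgebraO S) {z'}) ≤ lambdaInvariant p Y') :
    lambdaInvariant p (H ⧸ Submodule.span (IwasawaAlgebraO S) {z}) ≤ lambdaInvariant p Y := by
  -- the induced map on the quotients by the cyclic submodules is again a quasi-isomorphism
  have hq := lambdaInvariant_eq_of_finite_ker_coker_iwasawaAlgebraO
    ((Submodule.span (IwasawaAlgebraO S) {z'}).mapQ (Submodule.span (IwasawaAlgebraO S) {eH z'}) eH
      (span_singleton_le_comap_span_singleton eH z'))
    (finite_ker_mapQ_span_singleton eH z' hkerH) (finite_quotient_range_mapQ_span_singleton eH z' hcokerH)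
  rw [heH] at hq
  rw [← hq, ← lambdaInvariant_eq_of_finite_ker_coker_iwasawaAlgebraO eY hkerY hcokerY]
  exact hK'

end Summit.BirchSwinnertonDyer.BirchSwinnertonDyer.Theorems.SmallImageRttCharRoad

end
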